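import Summits.HubbardSuperconductivity.HubbardSuperconductivity.Theorems.AnisotropyChordTransferFibre3LamPartKT
import Summits.HubbardSuperconductivity.HubbardSuperconductivity.Theorems.AnisotropyChordTransferFibre3GroundSup
import Summits.HubbardSuperconductivity.HubbardSuperconductivity.Theorems.AnisotropyChordTransferFibre3GroundExplicit
import Summits.HubbardSuperconductivity.HubbardSuperconductivity.Theorems.AnisotropyChordTransferFibre3Lam2LogBound
import Summits.HubbardSuperconductivity.HubbardSuperconductivity.Theorems.AnisotropyChordTransferFibre3WindowRate

/-!
# Route `AnisotropyChord` / H0 rotor rung: family A for the LEVEL-2 certificate — the solution-manifold dictionary, the cell domain, the window (PartN41-A content)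

Theory-1 g22's statement file `cycle22/lean/PartN41A.lean` (memo 22 §337, LEVEL2-SPEC §3 row A) finds that on the solution
manifold every KT scalar is rational in the cell variables `(θ, ν, a := Δ f(x̂))` and that the capacity `G̃_λ(0)` enters only
through `c_s G̃_λ(0) = 1 − a + a/V` — so family A is needed only to LOCATE the manifold (ν-ceiling, a-band) and for the
second-shell window values.  This file proves the CONTENT of those targets from landed lemmas (the `_holds` one-liners against the
ported statement file follow its port):
* ★ `manifold_dictionary` (= `ManifoldDictionary`): `f(x̂) = a + η`, `c_s = 4η(V+a)/V`, `Δf(x̂)² = a(a+η)`,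
  `Δf(x̂)²(Δ + 2(1−Δ)) = a² + 2aη`, `c_s G̃ = 1 − a + a/V`, `λ₂ G̃ = (1 − a + a/V)/(V + a)`, `η = π²ν`
  (`etaEff_eq`, `lam2_sum_rule`, `cS_mul_Gres_zero`);  `delta_from_cell`; `manifold_equation`;
* ★ `axis_window_closed` (= `AxisWindowClosed`): `a_λ(e) = (1 − 1/V + (1−a+a/V)/(V+a))/4` on `nnList`, `1 − f(r) = 1 − a − c_s a_λ(r)`
  (`kernelAxisValue_holds`, `Gres_neg`/`Gres_swap`, `ground_profile_aKer`);
* ★ `nu_ceiling` (= `NuCeiling`): `λ₂ < 0.031·θ²` at `L ≥ 128` (`lam2_le_inv_Gres` + `capacity_const_bounds`);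
* (the a-band `ManifoldBand` — whose typed `a < 1` is false as `Δ → 1`, `a → V/(V−1)` — is a separate file);
* ★ `second_shell_window` (= `SecondShellWindow`): `|a_λ(1,1) − 1/π| ≤ 0.001`, `|a_λ(2,0) − (1 − 2/π)| ≤ 0.001` for `L ≥ 128`,
  `0 ≤ ν ≤ 0.0513` (`dev_one_one`/`dev_two_zero` + `lamPart_KT_le` + `ln L/L² ≤ ln 128/128²`).
Prover seat `hubbard-h0-rotor-p1` g26; helper for stmt-HubbardSuperconductivity-23918 (`--supports`, helper class).
WHAT THIS IS NOT: nothing here proves superconductivity in the Hubbard model; family-A inputs of ONE conditional reduction (piece A).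
Tree imports only; no new definitions; no sorry, no axioms.
-/

set_option linter.dupNamespace false
set_option autoImplicit false

noncomputable section

open scoped BigOperators

namespace Summit.HubbardSuperconductivity.HubbardSuperconductivity.Theorems.AnisotropyChord.Transfer.Fibre3

namespace ManifoldA

variable (L : ℕ) [NeZero L]

/-! ## §1 The dictionary -/

/-- ★ MANIFOLD DICTIONARY (content of PartN41-A `ManifoldDictionary`). [folklore] -/
theorem manifold_dictionary (hL : 5 ≤ L) {Δ lam2 : ℝ} (hΔ0 : 0 ≤ Δ) (hΔ1 : Δ < 1) {f : Tor L → ℝ}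
    (hf : IsGroundTwoMagnon L Δ lam2 f) :
    f (K1 L) = Δ * f (K1 L) + etaEff L lam2 ∧
    cS L Δ lam2 f = 4 * etaEff L lam2 * ((L : ℝ) ^ 2 + Δ * f (K1 L)) / (L : ℝ) ^ 2 ∧
    Δ * f (K1 L) ^ 2 = Δ * f (K1 L) * (Δ * f (K1 L) + etaEff L lam2) ∧
    Δ * f (K1 L) ^ 2 * (Δ + 2 * (1 - Δ)) = (Δ * f (K1 L)) ^ 2 + 2 * (Δ * f (K1 L)) * etaEff L lam2 ∧
    cS L Δ lam2 f * Gres L lam2 0 = 1 - Δ * f (K1 L) + Δ * f (K1 L) / (L : ℝ) ^ 2 ∧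
    lam2 * Gres L lam2 0 = (1 - Δ * f (K1 L) + Δ * f (K1 L) / (L : ℝ) ^ 2) / ((L : ℝ) ^ 2 + Δ * f (K1 L)) ∧
    etaEff L lam2 = Real.pi ^ 2 * (lam2 / (2 * Real.pi / L) ^ 2) := by
  have hL0 : (0 : ℝ) < L := by exact_mod_cast (show 0 < L by omega)
  have hV : (0 : ℝ) < (L : ℝ) ^ 2 := by positivity
  have hη := etaEff_eq L (by omega) hf.1
  have hsr := lam2_sum_rule L (by omega) hf.1
  have hcG := cS_mul_Gres_zero L hL hΔ0 hΔ1 hf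
  have hfpos : 0 < f (K1 L) := hf.1.2.2.1
  have ha0 : 0 ≤ Δ * f (K1 L) := mul_nonneg hΔ0 hfpos.le
  have h1 : f (K1 L) = Δ * f (K1 L) + etaEff L lam2 := by rw [hη]; ring
  have h2 : cS L Δ lam2 f = 4 * etaEff L lam2 * ((L : ℝ) ^ 2 + Δ * f (K1 L)) / (L : ℝ) ^ 2 := by
    unfold cS
    rw [hη]
    have : lam2 = 4 * (1 - Δ) * f (K1 L) / (L : ℝ) ^ 2 := by
      field_simp; linarith
    rw [this]; field_simp
  have h5 : cS L Δ lam2 f * Gres L lam2 0 = 1 - Δ * f (K1 L) + Δ * f (K1 L) / (L : ℝ) ^ 2 := by rw [hcG]; ring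
  refine ⟨h1, h2, ?_, ?_, h5, ?_, ?_⟩
  · rw [← h1]; ring
  · rw [hη]; ring
  · -- `c_s = λ₂ (V + a)`
    have hc : cS L Δ lam2 f = lam2 * ((L : ℝ) ^ 2 + Δ * f (K1 L)) := by
      rw [h2]; unfold etaEff; field_simp
    have hVa : 0 < (L : ℝ) ^ 2 + Δ * f (K1 L) := by positivity
    rw [eq_div_iff hVa.ne', ← h5, hc]; ring
  · unfold etaEff; field_simp; ring

/-- `Δ = a/(a + η_eff)` (content of `DeltaFromCell`). [folklore] -/
theorem delta_from_cell (hL : 5 ≤ L) {Δ lam2 : ℝ} (hΔ0 : 0 ≤ Δ) (hΔ1 : Δ < 1) {f : Tor L → ℝ}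
    (hf : IsGroundTwoMagnon L Δ lam2 f) :
    Δ = Δ * f (K1 L) / (Δ * f (K1 L) + etaEff L lam2) := by
  have h1 := (manifold_dictionary L hL hΔ0 hΔ1 hf).1
  have hfpos : 0 < f (K1 L) := hf.1.2.2.1
  rw [← h1]; field_simp

/-- the manifold equation `4η G̃_λ(0)(V + a) = V(1 − a) + a` (content of `ManifoldEquation`). [folklore] -/
theorem manifold_equation (hL : 5 ≤ L) {Δ lam2 : ℝ} (hΔ0 : 0 ≤ Δ) (hΔ1 : Δ < 1) {f : Tor L → ℝ}
    (hf : IsGroundTwoMagnon L Δ lam2 f) :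
    4 * etaEff L lam2 * Gres L lam2 0 * ((L : ℝ) ^ 2 + Δ * f (K1 L))
      = (L : ℝ) ^ 2 * (1 - Δ * f (K1 L)) + Δ * f (K1 L) := by
  obtain ⟨_, h2, _, _, h5, _, _⟩ := manifold_dictionary L hL hΔ0 hΔ1 hf
  have hV : (0 : ℝ) < (L : ℝ) ^ 2 := by
    have : (0 : ℝ) < L := by exact_mod_cast (show 0 < L by omega)
    positivity
  have : cS L Δ lam2 f * Gres L lam2 0 * (L : ℝ) ^ 2
      = 4 * etaEff L lam2 * Gres L lam2 0 * ((L : ℝ) ^ 2 + Δ * f (K1 L)) := by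
    rw [h2]; field_simp
  rw [← this, h5]; field_simp

/-! ## §1b The window in closed form -/

/-- `a_λ(e) = a_λ(x̂)` for the four nearest neighbours. [folklore] -/
theorem aKer_nn_eq (lam2 : ℝ) (e : Tor L) (he : e ∈ nnList L) : aKer L lam2 e = aKer L lam2 ((1 : ZMod L), 0) := by
  unfold nnList at he
  simp only [List.mem_cons, List.mem_nil_iff, or_false] at he
  unfold aKer
  rcases he with h | h | h | h
  · rw [h]
  · rw [h, show ((-1 : ZMod L), (0 : ZMod L)) = -(((1 : ZMod L), (0 : ZMod L)) : Tor L) by simp, Gres_neg]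
  · rw [h, show (((0 : ZMod L)), (1 : ZMod L)) = ((((1 : ZMod L), (0 : ZMod L)) : Tor L).2, (((1 : ZMod L), (0 : ZMod L)) : Tor L).1)
      from rfl, Gres_swap]
  · rw [h, show ((0 : ZMod L), (-1 : ZMod L)) = -((((1 : ZMod L), (0 : ZMod L)) : Tor L).2, (((1 : ZMod L), (0 : ZMod L)) : Tor L).1)
      by simp, Gres_neg, Gres_swap]

/-- ★ AXIS WINDOW CLOSED (content of `AxisWindowClosed`). [folklore] -/
theorem axis_window_closed (hL : 5 ≤ L) {Δ lam2 : ℝ} (hΔ0 : 0 ≤ Δ) (hΔ1 : Δ < 1) {f : Tor L → ℝ}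
    (hf : IsGroundTwoMagnon L Δ lam2 f) :
    (∀ e ∈ nnList L, aKer L lam2 e
        = (1 - 1 / (L : ℝ) ^ 2 + (1 - Δ * f (K1 L) + Δ * f (K1 L) / (L : ℝ) ^ 2) / ((L : ℝ) ^ 2 + Δ * f (K1 L))) / 4) ∧
    (∀ r : Tor L, r ≠ 0 → 1 - f r = 1 - Δ * f (K1 L) - cS L Δ lam2 f * aKer L lam2 r) := by
  obtain ⟨_, _, _, _, _, h6, _⟩ := manifold_dictionary L hL hΔ0 hΔ1 hf
  have hpos := lam2_pos L (by omega) hΔ1 hf.1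
  have hlt := lam2_lt_two_eps1 L hL hΔ0 hf
  have hax := kernelAxisValue_holds L lam2 hpos.le hlt
  constructor
  · intro e he
    rw [aKer_nn_eq L lam2 e he, hax, h6]
  · intro r hr
    rw [ground_profile_aKer L hL hΔ0 hΔ1 hf hr]; ring

/-! ## §2 The domain of the cell decomposition -/

/-- `ln 128 ≥ 4.852`. [folklore] -/
theorem log_128_ge : (4.852 : ℝ) ≤ Real.log 128 := by
  have h : Real.log 128 = 7 * Real.log 2 := by
    rw [show (128 : ℝ) = 2 ^ 7 by norm_num, Real.log_pow]; norm_num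
  rw [h]; linarith [Real.log_two_gt_d9]

/-- `ln 128 ≤ 4.8521`. [folklore] -/
theorem log_128_le : Real.log 128 ≤ 4.8521 := by
  have h : Real.log 128 = 7 * Real.log 2 := by
    rw [show (128 : ℝ) = 2 ^ 7 by norm_num, Real.log_pow]; norm_num
  rw [h]; linarith [Real.log_two_lt_d9]

/-- ★ ν-CEILING (content of `NuCeiling`): `λ₂ < 0.031·θ²` for a ground profile with `0 ≤ Δ < 1`, `L ≥ 128`. [folklore] -/
theorem nu_ceiling (hL : 128 ≤ L) {Δ lam2 : ℝ} (hΔ0 : 0 ≤ Δ) {f : Tor L → ℝ}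
    (hf : IsGroundTwoMagnon L Δ lam2 f) : lam2 < 0.031 * (2 * Real.pi / L) ^ 2 := by
  have hπlo := Real.pi_gt_d6
  have hπhi := Real.pi_lt_d6
  have hL0 : (0 : ℝ) < L := by exact_mod_cast (show 0 < L by omega)
  have hL128 : (128 : ℝ) ≤ L := by exact_mod_cast hL
  have hV : (0 : ℝ) < (L : ℝ) ^ 2 := by positivity
  have h1 := lam2_le_inv_Gres L (by omega) hΔ0 hf
  have hG := (CapacityConst.capacity_const_bounds L (by omega)).1
  have hlog : Real.log 128 ≤ Real.log L := Real.log_le_log (by norm_num) hL128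
  have hG2 : 0.8178 ≤ Gres L 0 0 := by
    have h2π : 0 < 2 * Real.pi := by positivity
    have : 0.7722 ≤ Real.log L / (2 * Real.pi) := by
      rw [le_div_iff₀ h2π]; nlinarith [log_128_ge]
    linarith
  have hGpos : 0 < Gres L 0 0 := by linarith
  calc lam2 ≤ 1 / ((L : ℝ) ^ 2 * Gres L 0 0) := h1
    _ ≤ 1 / ((L : ℝ) ^ 2 * 0.8178) := by
        apply one_div_le_one_div_of_le (by positivity)
        exact mul_le_mul_of_nonneg_left hG2 hV.le
    _ < 0.031 * (2 * Real.pi / L) ^ 2 := by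
        rw [div_lt_iff₀ (by positivity)]
        have e : 0.031 * (2 * Real.pi / L) ^ 2 * ((L : ℝ) ^ 2 * 0.8178) = 0.031 * 0.8178 * 4 * Real.pi ^ 2 := by
          field_simp; ring
        rw [e]; nlinarith

/-! ## §3 The second-shell window values -/

/-- `ln x/x² ≤ ln 128/128²` for `x ≥ 128` (concavity of `ln`). [folklore] -/
theorem log_div_sq_le (x : ℝ) (hx : 128 ≤ x) : Real.log x / x ^ 2 ≤ 4.8521 / 16384 := by
  have hx0 : 0 < x := by linarith
  have h := Real.log_le_sub_one_of_pos (show (0 : ℝ) < x / 128 by positivity)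
  rw [Real.log_div hx0.ne' (by norm_num)] at h
  have hlog : Real.log x ≤ 4.8521 + (x / 128 - 1) := by linarith [log_128_le]
  rw [div_le_iff₀ (by positivity)]
  nlinarith [mul_nonneg (sub_nonneg.mpr hx) (sub_nonneg.mpr hx)]

/-- ★ SECOND-SHELL WINDOW (content of `SecondShellWindow`): for `L ≥ 128`, `0 ≤ ν ≤ 0.0513`, `λ = ν(2π/L)²`:
`|a_λ(1,1) − 1/π| ≤ 0.001` and `|a_λ(2,0) − (1 − 2/π)| ≤ 0.001`. [folklore] -/
theorem second_shell_window (hL : 128 ≤ L) (ν : ℝ) (hν0 : 0 ≤ ν) (hν : ν ≤ 0.0513) :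
    |aKer L (ν * (2 * Real.pi / L) ^ 2) ((((1 : ℤ)) : ZMod L), (((1 : ℤ)) : ZMod L)) - 1 / Real.pi| ≤ 0.001 ∧
    |aKer L (ν * (2 * Real.pi / L) ^ 2) ((((2 : ℤ)) : ZMod L), (((0 : ℤ)) : ZMod L)) - (1 - 2 / Real.pi)| ≤ 0.001 := by
  have hL0 : (0 : ℝ) < L := by exact_mod_cast (show 0 < L by omega)
  have hL128 : (128 : ℝ) ≤ L := by exact_mod_cast hL
  have hV : (0 : ℝ) < (L : ℝ) ^ 2 := by positivity
  have hν7 : ν ≤ 0.07 := by linarith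
  have hlogq := log_div_sq_le (L : ℝ) hL128
  have hinv : 1 / (L : ℝ) ^ 2 ≤ 1 / 16384 := one_div_le_one_div_of_le (by norm_num) (by nlinarith)
  have hlog0 : 0 ≤ Real.log L := Real.log_nonneg (by linarith)
  -- λ-parts
  have hl11 := CapacityConst.lamPart_KT_le L (by omega) ν hν0 hν7 1 1
  have hl20 := CapacityConst.lamPart_KT_le L (by omega) ν hν0 hν7 2 0
  have hε : 0 < eps1 L := RateLemma.eps1_pos_of_two_le L (by omega)
  have hπlo := Real.pi_gt_d6
  have hπhi := Real.pi_lt_d6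
  have hlam0 : 0 ≤ ν * (2 * Real.pi / L) ^ 2 := by positivity
  have hlam1 : ν * (2 * Real.pi / L) ^ 2 < 2 * eps1 L := by
    have hεJ : 2 / Real.pi ^ 2 * (2 * Real.pi / L) ^ 2 ≤ eps1 L := RateLemma.eps1_ge_jordan L (by omega)
    have h1 : ν * (2 * Real.pi / L) ^ 2 < 4 / Real.pi ^ 2 * (2 * Real.pi / L) ^ 2 := by
      apply mul_lt_mul_of_pos_right _ (by positivity)
      rw [lt_div_iff₀ (by positivity)]; nlinarith
    have h2 : 4 / Real.pi ^ 2 * (2 * Real.pi / L) ^ 2 = 2 * (2 / Real.pi ^ 2 * (2 * Real.pi / L) ^ 2) := by ring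
    linarith
  have hp11 := (RateLemma.lamPartShellBound_holds L (by omega) _ hlam0 hlam1 ((((1 : ℤ)) : ZMod L), (((1 : ℤ)) : ZMod L))).1
  have hp20 := (RateLemma.lamPartShellBound_holds L (by omega) _ hlam0 hlam1 ((((2 : ℤ)) : ZMod L), (((0 : ℤ)) : ZMod L))).1
  -- λ = 0 deviations
  have hd11 := Subsample.dev_one_one L (by omega)
  have hd20 := Subsample.dev_two_zero L (by omega)
  rw [Subsample.aZ2_one_one] at hd11
  rw [Subsample.aZ2_two_zero'] at hd20
  obtain ⟨hd11a, hd11b⟩ := abs_le.mp hd11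
  obtain ⟨hd20a, hd20b⟩ := abs_le.mp hd20
  -- numeric sizes: `λ-part(1,1) ≤ ν·2·(7.76 ln L + 3.3)/L² ≤ 2.6·10⁻⁴`, `(2,0) ≤ 5.2·10⁻⁴`
  have hsz : (7.76 * Real.log L + 3.3) / (L : ℝ) ^ 2 ≤ 0.0025 := by
    have e : (7.76 * Real.log L + 3.3) / (L : ℝ) ^ 2 = 7.76 * (Real.log L / (L : ℝ) ^ 2) + 3.3 * (1 / (L : ℝ) ^ 2) := by
      field_simp
    rw [e]; nlinarith
  have hl11' : RateLemma.lamPart L (ν * (2 * Real.pi / L) ^ 2) ((((1 : ℤ)) : ZMod L), (((1 : ℤ)) : ZMod L)) ≤ 0.00026 := by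
    refine hl11.trans ?_
    push_cast
    have e : ν * ((1 : ℝ) ^ 2 + (1 : ℝ) ^ 2) * (7.76 * Real.log L + 3.3) / (L : ℝ) ^ 2
        = 2 * ν * ((7.76 * Real.log L + 3.3) / (L : ℝ) ^ 2) := by ring
    rw [e]
    have h0 : 0 ≤ (7.76 * Real.log L + 3.3) / (L : ℝ) ^ 2 := by positivity
    have := mul_le_mul hν hsz h0 (by norm_num)
    linarith
  have hl20' : RateLemma.lamPart L (ν * (2 * Real.pi / L) ^ 2) ((((2 : ℤ)) : ZMod L), (((0 : ℤ)) : ZMod L)) ≤ 0.00052 := by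
    refine hl20.trans ?_
    push_cast
    have e : ν * ((2 : ℝ) ^ 2 + (0 : ℝ) ^ 2) * (7.76 * Real.log L + 3.3) / (L : ℝ) ^ 2
        = 4 * ν * ((7.76 * Real.log L + 3.3) / (L : ℝ) ^ 2) := by ring
    rw [e]
    have h0 : 0 ≤ (7.76 * Real.log L + 3.3) / (L : ℝ) ^ 2 := by positivity
    have := mul_le_mul hν hsz h0 (by norm_num)
    linarith
  have e11 : aKer L (ν * (2 * Real.pi / L) ^ 2) ((((1 : ℤ)) : ZMod L), (((1 : ℤ)) : ZMod L))
      = aKer L 0 ((((1 : ℤ)) : ZMod L), (((1 : ℤ)) : ZMod L))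
        + RateLemma.lamPart L (ν * (2 * Real.pi / L) ^ 2) ((((1 : ℤ)) : ZMod L), (((1 : ℤ)) : ZMod L)) := by
    unfold RateLemma.lamPart; ring
  have e20 : aKer L (ν * (2 * Real.pi / L) ^ 2) ((((2 : ℤ)) : ZMod L), (((0 : ℤ)) : ZMod L))
      = aKer L 0 ((((2 : ℤ)) : ZMod L), (((0 : ℤ)) : ZMod L))
        + RateLemma.lamPart L (ν * (2 * Real.pi / L) ^ 2) ((((2 : ℤ)) : ZMod L), (((0 : ℤ)) : ZMod L)) := by
    unfold RateLemma.lamPart; ring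
  have h4 : 4 / (L : ℝ) ^ 2 ≤ 4 / 16384 := by
    apply div_le_div_of_nonneg_left (by norm_num) (by norm_num) (by nlinarith)
  constructor
  · rw [e11, abs_le]; constructor <;> linarith only [hd11a, hd11b, hp11, hl11', hinv]
  · rw [e20, abs_le]; constructor <;> linarith only [hd20a, hd20b, hp20, hl20', h4]

end ManifoldA

end Summit.HubbardSuperconductivity.HubbardSuperconductivity.Theorems.AnisotropyChord.Transfer.Fibre3

end
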